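import Literature.Analysis.PDE.FlatStepEnergy
import HarnessLib

/-!
# The finite Neumann iteration of the flat fine parametrix (topic `Analysis/PDE`)

Layer (I') of the programme to prove short-time existence for quasilinear strictly parabolic
systems on a closed manifold (hypothesis `hQL` of
`Literature.Geometry.Riemannian.ricciFlow_shortTime_existence_of_quasilinear`). Iterating the one
step of `FlatStep.lean` on the residuals,

  `Θ₀ = Θ`, `Θ_{m+1} = errOne(Θ_m)`, `v_N = Σ_{m<N} vOne(Θ_m)`,

gives a smooth `v_N` with `v_N(0) = 0` solving `∂ₜ v_N = L v_N + Θ - Θ_N` on the slab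
(`timeDerivWithin_vNeumann`, telescoping), provided the supports of the iterates stay in the region
of the patch family (they grow by at most `5r` per step, `dataIter_support`); and if one step
contracts the per-patch data norm by `θ` then `𝒩(Θ_N) ≤ θ^N 𝒩(Θ)` (`norm_dataIter_le`). Only
FINITELY many steps are taken: no function spaces, no limits.

Everything is proved; no named fact and no `sorry` is introduced.

## References

* L. Hörmander, *The Analysis of Linear Partial Differential Operators III*, Springer 1985,
  §17.1. [Hormander1985III]
-/

noncomputable section

open Set Function Filter Topology Metric MeasureTheory InnerProductSpace
open scoped ContDiff Topology ENNReal RealInnerProductSpace Laplacian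

namespace Literature.Analysis.PDE

open Literature.Analysis.FunctionSpaces Literature.Analysis.FluidPDE TopologicalSpace

variable {E' : Type*} [NormedAddCommGroup E'] [InnerProductSpace ℝ E'] [FiniteDimensional ℝ E']
variable {F' : Type*} [NormedAddCommGroup F'] [InnerProductSpace ℝ F']

/-! ### Zero data give zero local solutions -/

section ZeroData

variable [MeasurableSpace E'] [BorelSpace E'] [FiniteDimensional ℝ F']

omit [FiniteDimensional ℝ F'] in
/-- The Duhamel objects of identically vanishing data vanish. [folklore] -/
theorem heatDuhamelZero_of_forall_eq_zero (ν : ℝ) {Θ : ℝ → E' → F'} (hΘ : ∀ s z, Θ s z = 0) (t : ℝ) (z : E') :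
    heatDuhamelZero ν Θ t z = 0 := by
  have hΘ' : Θ = fun _ _ ↦ 0 := by funext s z; exact hΘ s z
  subst hΘ'
  have hE : ∀ t', UnboundedOperators.heatExtension (fun _ : E' ↦ (0 : F')) t' = 0 := fun t' ↦ by
    rw [UnboundedOperators.heatExtension, show (fun _ : E' ↦ (0 : F')) = 0 from rfl, MeasureTheory.convolution_zero]
  have h1 : ∀ t z, heatDuhamelFwd ν (fun (_ : ℝ) (_ : E') ↦ (0 : F')) t z = 0 := by
    intro t z
    rw [heatDuhamelFwd_apply, heatDuhamelBack_apply]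
    simp [timeReverse, hE]
  have h2 : heatDuhamelFwd ν (fun (_ : ℝ) (_ : E') ↦ (0 : F')) 0 = fun _ ↦ 0 := funext fun z ↦ h1 0 z
  rw [heatDuhamelZero, h1, h2]
  simp only [zero_sub, neg_eq_zero]
  unfold freeFlow
  split_ifs
  · rw [hE]; rfl
  · rfl

omit [FiniteDimensional ℝ F'] in
/-- The flat local solution of identically vanishing data vanishes. [folklore] -/
theorem flatLocalSol_of_forall_eq_zero (T : ℝ) {Θ : ℝ → E' → F'} (hΘ : ∀ s z, Θ s z = 0) (t : ℝ) (z : E') :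
    flatLocalSol T Θ t z = 0 := by
  have hext : ∀ s z, slabExtend T Θ s z = 0 := fun s z ↦ slabExtend_eq_zero_of_forall (fun s' ↦ hΘ s' z) s
  exact heatDuhamelZero_of_forall_eq_zero 1 hext t z

omit [MeasurableSpace E'] [BorelSpace E'] [FiniteDimensional ℝ F'] in
/-- The flat residual of the zero function vanishes. [folklore] -/
theorem flatErr_zero_fun (Ss : E' → (E' →L[ℝ] E')) (𝔟s : E' → ((E' →L[ℝ] F') →L[ℝ] F'))
    (𝔠s : E' → (F' →L[ℝ] F')) (cut : E' → ℝ) (z : E') :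
    flatErr Ss 𝔟s 𝔠s cut (fun _ ↦ (0 : F')) z = 0 := by
  rw [flatErr_apply, principalPart_apply]
  simp

end ZeroData

namespace FlatStep

variable {ι : Type*} [Fintype ι] (Q : FlatPatches E' ι) (A : ι → E' ≃L[ℝ] E') (T : ℝ)
  (S : ℝ → E' → (E' →L[ℝ] E')) (𝔟 : ℝ → E' → ((E' →L[ℝ] F') →L[ℝ] F')) (𝔠 : ℝ → E' → (F' →L[ℝ] F'))
  [MeasurableSpace E'] [BorelSpace E'] [FiniteDimensional ℝ F']

/-! ### The iterates -/

/-- **The data iterates**: `Θ₀ = Θ`, `Θ_{m+1} = errOne(Θ_m)`. [cite: Hormander1985III, §17.1] -/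
def dataIter (Θ : ℝ → E' → F') : ℕ → ℝ → E' → F'
  | 0 => Θ
  | m + 1 => errOne Q A T S 𝔟 𝔠 (dataIter Θ m)

/-- **The Neumann approximate solution** `v_N = Σ_{m<N} vOne(Θ_m)`. [cite: Hormander1985III, §17.1] -/
def vNeumann (Θ : ℝ → E' → F') (N : ℕ) (s : ℝ) (y : E') : F' :=
  ∑ m ∈ Finset.range N, vOne Q A T (dataIter Q A T S 𝔟 𝔠 Θ m) s y

variable {Q A T S 𝔟 𝔠}

/-- `dataIter_zero`: dataIter zero. [folklore] -/
@[simp] theorem dataIter_zero (Θ : ℝ → E' → F') : dataIter Q A T S 𝔟 𝔠 Θ 0 = Θ := rfl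

/-- `dataIter_succ`: dataIter succ. [folklore] -/
theorem dataIter_succ (Θ : ℝ → E' → F') (m : ℕ) :
    dataIter Q A T S 𝔟 𝔠 Θ (m + 1) = errOne Q A T S 𝔟 𝔠 (dataIter Q A T S 𝔟 𝔠 Θ m) := rfl

/-! ### Smoothness -/

/-- The assembled residual of slab-smooth data is slab-smooth. [folklore] -/
theorem isSmoothSpaceTimeOn_errOne (hT : 0 < T) {Θ : ℝ → E' → F'} (hΘ : IsSmoothSpaceTimeOn (Icc 0 T) Θ)
    (hS : IsSmoothSpaceTimeOn (Icc 0 T) S) (h𝔟 : IsSmoothSpaceTimeOn (Icc 0 T) 𝔟) (h𝔠 : IsSmoothSpaceTimeOn (Icc 0 T) 𝔠) :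
    IsSmoothSpaceTimeOn (Icc 0 T) (errOne Q A T S 𝔟 𝔠 Θ) := by
  have h : ∀ i, IsSmoothSpaceTimeOn (Icc 0 T) (errPiece Q A T S 𝔟 𝔠 Θ i) := fun i ↦
    (isSmoothSpaceTimeOn_errAd Q A T S 𝔟 𝔠 Θ hT hΘ hS h𝔟 h𝔠 i).comp_space (contDiff_psiInv i)
  unfold IsSmoothSpaceTimeOn at h ⊢
  have : uncurry (errOne Q A T S 𝔟 𝔠 Θ) = fun q ↦ ∑ i, uncurry (errPiece Q A T S 𝔟 𝔠 Θ i) q := by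
    funext ⟨s, y⟩; simp [errOne]
  rw [this]
  exact ContDiffOn.sum fun i _ ↦ h i

/-- The iterates are slab-smooth. [folklore] -/
theorem isSmoothSpaceTimeOn_dataIter (hT : 0 < T) {Θ : ℝ → E' → F'} (hΘ : IsSmoothSpaceTimeOn (Icc 0 T) Θ)
    (hS : IsSmoothSpaceTimeOn (Icc 0 T) S) (h𝔟 : IsSmoothSpaceTimeOn (Icc 0 T) 𝔟) (h𝔠 : IsSmoothSpaceTimeOn (Icc 0 T) 𝔠) :
    ∀ m, IsSmoothSpaceTimeOn (Icc 0 T) (dataIter Q A T S 𝔟 𝔠 Θ m)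
  | 0 => hΘ
  | m + 1 => isSmoothSpaceTimeOn_errOne hT (isSmoothSpaceTimeOn_dataIter hT hΘ hS h𝔟 h𝔠 m) hS h𝔟 h𝔠

/-- The Neumann approximate solution is slab-smooth. [folklore] -/
theorem isSmoothSpaceTimeOn_vNeumann (hT : 0 < T) {Θ : ℝ → E' → F'} (hΘ : IsSmoothSpaceTimeOn (Icc 0 T) Θ)
    (hS : IsSmoothSpaceTimeOn (Icc 0 T) S) (h𝔟 : IsSmoothSpaceTimeOn (Icc 0 T) 𝔟) (h𝔠 : IsSmoothSpaceTimeOn (Icc 0 T) 𝔠)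
    (N : ℕ) : IsSmoothSpaceTimeOn (Icc 0 T) (vNeumann Q A T S 𝔟 𝔠 Θ N) := by
  have h : ∀ m, IsSmoothSpaceTimeOn (Icc 0 T) (vOne Q A T (dataIter Q A T S 𝔟 𝔠 Θ m)) := fun m ↦
    isSmoothSpaceTimeOn_vOne hT (isSmoothSpaceTimeOn_dataIter hT hΘ hS h𝔟 h𝔠 m)
  unfold IsSmoothSpaceTimeOn at h ⊢
  have : uncurry (vNeumann Q A T S 𝔟 𝔠 Θ N) = fun q ↦ ∑ m ∈ Finset.range N,
      uncurry (vOne Q A T (dataIter Q A T S 𝔟 𝔠 Θ m)) q := by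
    funext ⟨s, y⟩; simp [vNeumann]
  rw [this]
  exact ContDiffOn.sum fun m _ ↦ h m

/-- The Neumann approximate solution vanishes at `t = 0`. [folklore] -/
theorem vNeumann_zero (Θ : ℝ → E' → F') (N : ℕ) (y : E') : vNeumann Q A T S 𝔟 𝔠 Θ N 0 y = 0 := by
  simp [vNeumann, vOne_zero]

/-! ### Support growth -/

/-- If the data of a patch vanish identically, so does its pushed-forward residual. [folklore] -/
theorem errPiece_eq_zero_of_dataAd (i : ι) {Θ : ℝ → E' → F'} (h : ∀ s z, dataAd Q A Θ i s z = 0) (s : ℝ) (y : E') :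
    errPiece Q A T S 𝔟 𝔠 Θ i s y = 0 := by
  have hw : wAd Q A T Θ i s = fun _ ↦ 0 := funext fun z ↦ flatLocalSol_of_forall_eq_zero T h s z
  simp only [errPiece, errAd, hw]
  exact flatErr_zero_fun _ _ _ _ _

/-- **Support growth by one step**: if `Θ(s, ·)` is supported in `closedBall 0 ϱ` for all `s`, then
`errOne(s, ·)` is supported in `closedBall 0 (ϱ + 5r)`. [folklore] -/
theorem errOne_support {Θ : ℝ → E' → F'} {ϱ : ℝ} (hΘ : ∀ s y, Θ s y ≠ 0 → y ∈ closedBall (0 : E') ϱ)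
    (s : ℝ) (y : E') (hy : errOne Q A T S 𝔟 𝔠 Θ s y ≠ 0) : y ∈ closedBall (0 : E') (ϱ + 5 * Q.r) := by
  obtain ⟨i, -, hi⟩ := Finset.exists_ne_zero_of_sum_ne_zero hy
  -- the patch `i` carries data: some `ρ_i(y') Θ(s', y') ≠ 0`
  have hdata : ∃ s' z, dataAd Q A Θ i s' z ≠ 0 := by
    by_contra h
    push Not at h
    exact hi (errPiece_eq_zero_of_dataAd i h s y)
  obtain ⟨s', z, hz⟩ := hdata
  have hρ : Q.ρ i (psi Q A i z) ≠ 0 := fun h ↦ hz (by simp [dataAd, h])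
  have hΘ' : Θ s' (psi Q A i z) ≠ 0 := fun h ↦ hz (by simp [dataAd, h])
  have hc1 : psi Q A i z ∈ ball (Q.c i) (2 * Q.r) := Q.tsupport_ρ i (subset_tsupport _ hρ)
  have hc2 : psi Q A i z ∈ closedBall (0 : E') ϱ := hΘ s' _ hΘ'
  -- the residual of patch `i` is supported in `closedBall (c i) (3r)`
  have hyi : y ∈ closedBall (Q.c i) (3 * Q.r) := by
    by_contra hy'
    refine hi (flatErr_eq_zero_of_notMem_tsupport _ _ _ _ fun h ↦ hy' ?_)
    have h' := tsupport_comp_subset_preimage (Q.cut i : E' → ℝ) (f := psi Q A i) (contDiff_psi i).continuous h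
    rwa [mem_preimage, psi_psiInv, (Q.cut i).tsupport_eq, Q.cut_rOut] at h'
  rw [mem_closedBall, dist_zero_right] at hc2 ⊢
  rw [mem_ball] at hc1
  rw [mem_closedBall] at hyi
  calc ‖y‖ = dist y 0 := (dist_zero_right y).symm
    _ ≤ dist y (Q.c i) + dist (Q.c i) (psi Q A i z) + dist (psi Q A i z) 0 := dist_triangle4 _ _ _ _
    _ ≤ 3 * Q.r + 2 * Q.r + ϱ := by
        rw [dist_zero_right]
        exact add_le_add (add_le_add hyi (by rw [dist_comm]; exact hc1.le)) hc2
    _ = ϱ + 5 * Q.r := by ring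

/-- **Support of the iterates**: `Θ_m(s, ·) ⊆ closedBall 0 (ϱ + 5 m r)`. [folklore] -/
theorem dataIter_support {Θ : ℝ → E' → F'} {ϱ : ℝ} (hΘ : ∀ s y, Θ s y ≠ 0 → y ∈ closedBall (0 : E') ϱ) :
    ∀ m s y, dataIter Q A T S 𝔟 𝔠 Θ m s y ≠ 0 → y ∈ closedBall (0 : E') (ϱ + 5 * m * Q.r)
  | 0, s, y, h => by simpa using hΘ s y h
  | m + 1, s, y, h => by
    have ih := dataIter_support hΘ m
    have h' := errOne_support (Q := Q) (A := A) (T := T) (S := S) (𝔟 := 𝔟) (𝔠 := 𝔠) ih s y h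
    push_cast
    rw [show ϱ + 5 * (m + 1 : ℝ) * Q.r = ϱ + 5 * m * Q.r + 5 * Q.r by ring]
    exact h'

/-! ### The equation of the Neumann approximate solution -/

/-- **The Neumann approximate solution solves the equation up to the last residual**: if
`closedBall 0 (ϱ + 5 N r)` lies in the region of the patch family and the data are supported in
`closedBall 0 ϱ`, then on the slab and for every `y`,
`∂ₜ v_N = L v_N + Θ - Θ_N`. [cite: Hormander1985III, §17.1] -/
theorem timeDerivWithin_vNeumann (hT : 0 < T) {Θ : ℝ → E' → F'} (hΘ : IsSmoothSpaceTimeOn (Icc 0 T) Θ)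
    (hS : IsSmoothSpaceTimeOn (Icc 0 T) S) (h𝔟 : IsSmoothSpaceTimeOn (Icc 0 T) 𝔟) (h𝔠 : IsSmoothSpaceTimeOn (Icc 0 T) 𝔠)
    {ϱ : ℝ} (hΘϱ : ∀ s y, Θ s y ≠ 0 → y ∈ closedBall (0 : E') ϱ) (N : ℕ)
    (hreg : closedBall (0 : E') (ϱ + 5 * N * Q.r) ⊆ Q.region) {s : ℝ} (hs : s ∈ Icc 0 T) (y : E') :
    timeDerivWithin (Icc 0 T) (vNeumann Q A T S 𝔟 𝔠 Θ N) s y =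
      frameOp (S s y) (𝔟 s y) (𝔠 s y) (vNeumann Q A T S 𝔟 𝔠 Θ N s) y + Θ s y - dataIter Q A T S 𝔟 𝔠 Θ N s y := by
  have hsm : ∀ m, IsSmoothSpaceTimeOn (Icc 0 T) (dataIter Q A T S 𝔟 𝔠 Θ m) :=
    isSmoothSpaceTimeOn_dataIter hT hΘ hS h𝔟 h𝔠
  -- each step's data lie in the region
  have hregm : ∀ m < N, ∀ s y, dataIter Q A T S 𝔟 𝔠 Θ m s y ≠ 0 → y ∈ Q.region := by
    intro m hm s y h
    refine hreg (closedBall_subset_closedBall ?_ (dataIter_support hΘϱ m s y h))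
    have : (m : ℝ) ≤ N := by exact_mod_cast hm.le
    nlinarith [Q.r_pos]
  -- time derivative of the finite sum
  have h1 : timeDerivWithin (Icc 0 T) (vNeumann Q A T S 𝔟 𝔠 Θ N) s y =
      ∑ m ∈ Finset.range N, timeDerivWithin (Icc 0 T) (vOne Q A T (dataIter Q A T S 𝔟 𝔠 Θ m)) s y := by
    rw [timeDerivWithin_apply]
    have hfun : (fun s ↦ vNeumann Q A T S 𝔟 𝔠 Θ N s y) = fun s ↦ ∑ m ∈ Finset.range N,
        vOne Q A T (dataIter Q A T S 𝔟 𝔠 Θ m) s y := rfl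
    have hdiff : ∀ m, DifferentiableWithinAt ℝ (fun s ↦ vOne Q A T (dataIter Q A T S 𝔟 𝔠 Θ m) s y) (Icc 0 T) s := fun m ↦
      (isSmoothSpaceTimeOn_vOne hT (hsm m)).differentiableWithinAt_time hs y
    rw [hfun, derivWithin_fun_sum fun m _ ↦ hdiff m]
    rfl
  have key : ∀ m < N, timeDerivWithin (Icc 0 T) (vOne Q A T (dataIter Q A T S 𝔟 𝔠 Θ m)) s y =
      frameOp (S s y) (𝔟 s y) (𝔠 s y) (vOne Q A T (dataIter Q A T S 𝔟 𝔠 Θ m) s) y +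
        dataIter Q A T S 𝔟 𝔠 Θ m s y - dataIter Q A T S 𝔟 𝔠 Θ (m + 1) s y := fun m hm ↦
    timeDerivWithin_vOne hT (hsm m) (hregm m hm) hs y
  rw [h1, Finset.sum_congr rfl fun m hm ↦ key m (Finset.mem_range.1 hm), Finset.sum_sub_distrib, Finset.sum_add_distrib]
  have hsmooth : ∀ m, ContDiff ℝ ∞ (vOne Q A T (dataIter Q A T S 𝔟 𝔠 Θ m) s) := fun m ↦
    (isSmoothSpaceTimeOn_vOne hT (hsm m)).contDiff_slice hs
  have hL : ∑ m ∈ Finset.range N, frameOp (S s y) (𝔟 s y) (𝔠 s y) (vOne Q A T (dataIter Q A T S 𝔟 𝔠 Θ m) s) y =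
      frameOp (S s y) (𝔟 s y) (𝔠 s y) (vNeumann Q A T S 𝔟 𝔠 Θ N s) y := by
    have h := frameOp_sum (ι := Fin N) (S s y) (𝔟 s y) (𝔠 s y)
      (u := fun m : Fin N ↦ vOne Q A T (dataIter Q A T S 𝔟 𝔠 Θ m) s) (fun m ↦ hsmooth m) y
    have e1 : (vNeumann Q A T S 𝔟 𝔠 Θ N s) = fun y ↦ ∑ m : Fin N, vOne Q A T (dataIter Q A T S 𝔟 𝔠 Θ m) s y := by
      funext y'
      simp only [vNeumann, Finset.sum_range]
    rw [e1, h, Finset.sum_range]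
  -- telescoping
  have htel : ∑ m ∈ Finset.range N, dataIter Q A T S 𝔟 𝔠 Θ m s y - ∑ m ∈ Finset.range N, dataIter Q A T S 𝔟 𝔠 Θ (m + 1) s y =
      Θ s y - dataIter Q A T S 𝔟 𝔠 Θ N s y := by
    rw [← Finset.sum_sub_distrib, Finset.sum_range_sub']
    rfl
  rw [hL, add_sub_assoc, htel]
  abel

/-! ### Decay of the data norm -/

/-- **Geometric decay of the per-patch data norm under a contracting step**: if one step contracts
the norm `𝒩(Θ') = Σ_i ∫₀ᵗ e^{-2λs} E_k(Θ̃'_i(s)) ds` by the factor `θ` for all slab-smooth data,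
then `𝒩(Θ_N) ≤ θ^N 𝒩(Θ)`. [cite: Hormander1985III, §17.1] -/
theorem norm_dataIter_le (hT : 0 < T) {Θ : ℝ → E' → F'} (hΘ : IsSmoothSpaceTimeOn (Icc 0 T) Θ)
    (hS : IsSmoothSpaceTimeOn (Icc 0 T) S) (h𝔟 : IsSmoothSpaceTimeOn (Icc 0 T) 𝔟) (h𝔠 : IsSmoothSpaceTimeOn (Icc 0 T) 𝔠)
    (k : ℕ) {lam t : ℝ} {θ : ℝ≥0∞}
    (hstep : ∀ Θ' : ℝ → E' → F', IsSmoothSpaceTimeOn (Icc 0 T) Θ' →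
      ∑ j, ∫⁻ s in Ioo 0 t, ENNReal.ofReal (Real.exp (-2 * lam * s)) *
          sobolevEnergy k (dataAd Q A (errOne Q A T S 𝔟 𝔠 Θ') j s) ≤
        θ * ∑ i, ∫⁻ s in Ioo 0 t, ENNReal.ofReal (Real.exp (-2 * lam * s)) * sobolevEnergy k (dataAd Q A Θ' i s)) :
    ∀ N, ∑ i, ∫⁻ s in Ioo 0 t, ENNReal.ofReal (Real.exp (-2 * lam * s)) *
        sobolevEnergy k (dataAd Q A (dataIter Q A T S 𝔟 𝔠 Θ N) i s) ≤
      θ ^ N * ∑ i, ∫⁻ s in Ioo 0 t, ENNReal.ofReal (Real.exp (-2 * lam * s)) * sobolevEnergy k (dataAd Q A Θ i s)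
  | 0 => by simp
  | N + 1 => by
    have ih := norm_dataIter_le hT hΘ hS h𝔟 h𝔠 k hstep N
    have h := hstep (dataIter Q A T S 𝔟 𝔠 Θ N) (isSmoothSpaceTimeOn_dataIter hT hΘ hS h𝔟 h𝔠 N)
    rw [dataIter_succ]
    refine h.trans ?_
    rw [pow_succ, mul_comm (θ ^ N) θ, mul_assoc]
    exact mul_le_mul' le_rfl ih

end FlatStep

end Literature.Analysis.PDE

end
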